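import Mathlib
import HarnessLib
import Summits.Langlands.Langlands.Theorems.ParityBlindBianchiArtinWeightRealisationLevel
import Literature.NumberTheory.Automorphic.PiOfArtinRepAtSigmaUnramifiedPlaces
import Literature.NumberTheory.Automorphic.CuspidalRepGL2Exists

/-!
# R′ = `ParityBlindBianchi.ArtinWeightRealisationLevel` (crux stmt-Langlands-15111) MODULO item
stmt-Langlands-11057 and two Literature named facts — line `Sketch`, final bookkeeping (`--supports`)

The lead composition `artinWeightRealisationLevel_of_artinWeightRealisation` (landed,
`ParityBlindBianchiArtinWeightRealisationLevel.lean`) takes the two classical inputs written out.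
Both are now vendored as Literature named facts (D-0014):

* `Literature.NumberTheory.Automorphic.frobSatakeCompatibleAt_of_isPiOfArtinRep_of_isUnramifiedAt`
  (Gelbart 1997 Prop. 4.1, σ-unramified shadow; `Automorphic/PiOfArtinRepAtSigmaUnramifiedPlaces`);
* `Literature.NumberTheory.Automorphic.nonempty_cuspidalAutomorphicRepData_two` (cusp forms exist on
  `GL₂` over every number field, Gelbart 1975 Thm. 7.11 / Jacquet–Langlands §12;
  `Automorphic/CuspidalRepGL2Exists`).

This file restates the composition against the NAMED facts, so that the crux is recorded as
closed modulo exactly: item stmt-Langlands-11057 (the shared open crux R, the non-regular-weight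
wall) + these two named facts — `artinWeightRealisationLevel_of_facts`.  (The solvable sector,
`satakeFrobCompatibleAt_of_isSolvable_projectiveImage` of `…SolvableSector`, is restated against the
first fact in `…SolvableSectorModulo`.)  No definitions.
-/

noncomputable section

open scoped BigOperators Topology Classical Matrix NumberField MatrixGroups
open Literature.NumberTheory.Automorphic Literature.NumberTheory.GaloisRepresentations
  IsDedekindDomain NumberField Filter

-- `Summit.Langlands.Langlands.…`: summit = sub-problem name (D-0017 nested layout), not a typo.
set_option linter.dupNamespace false

namespace Summit.Langlands.Langlands.Theorems.ArtinWeightRealisationLevel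

/-- **R′ modulo R and two named facts.**  `ParityBlindBianchi.ArtinWeightRealisationLevel`
(stmt-Langlands-15111) follows from `RuelleTorsionArtinWeight.ArtinWeightRealisation`
(item stmt-Langlands-11057), Gelbart 1997 Prop. 4.1 (σ-unramified shadow, named fact) and the
existence of cuspidal automorphic representations of `GL₂` over every number field (named fact,
consumed only in the degenerate sector `0 ∈ S₀`).  [folklore] -/
theorem artinWeightRealisationLevel_of_facts : Summit.Langlands.Langlands.Theses.RuelleTorsionArtinWeight.ArtinWeightRealisation → Literature.NumberTheory.Automorphic.frobSatakeCompatibleAt_of_isPiOfArtinRep_of_isUnramifiedAt → Literature.NumberTheory.Automorphic.nonempty_cuspidalAutomorphicRepData_two → Summit.Langlands.Langlands.Theses.ParityBlindBianchi.ArtinWeightRealisationLevel :=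
  fun hR hG hC => artinWeightRealisationLevel_of_artinWeightRealisation hR
    (fun hcpt σ π hπ v hv => hG hcpt σ π hπ v hv) (fun F _ _ hF => hC F hF)

end Summit.Langlands.Langlands.Theorems.ArtinWeightRealisationLevel

end
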